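import Summits.BirchSwinnertonDyer.BirchSwinnertonDyer.Theorems.AlignedTransportAtTwoMainConjectureTransportAlignedAtTwoBuzzardKTwo
import Literature.NumberTheory.EllipticCurves.PAdicLFunctionDistributionProofs
import HarnessLib

/-!
# Crux C1 `MainConjectureTransportAlignedAtTwo` (stmt-BirchSwinnertonDyer-22296), line `birth`, plan «ord-plusline» step (A):
# TWO CONGRUENT EIGENFORMS AT ONE LEVEL — their `𝔪₀`-eigen period functionals AGREE MOD 2 on `H₁(X₀(N'); ℤ)`
# when `Δ(W₁) < 0`, `Δ(W₁) ∉ ℚ₂²` (lead att-p1 g9; `--supports 22296`)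

THEOREMS ONLY (no `def`, no `sorry`, no named fact). BSD is not proved by this; C1 is not closed by this.

The Λ-level two-curve application of (K2) (`…BuzzardKTwo.kTwo_of_dvd_S3`, p653088). Data: a globally minimal `S₃`-curve `W₁` with
`Δ(W₁) < 0`, `Δ(W₁)` not a `2`-adic square, its newform `f₁` of level `N`, a nonempty finite set of primes `S`, an odd level `N'` with
`N·∏_{ℓ∈S} ℓ² ∣ N'`, `primes(N') ⊆ S`, good reduction of `W₁` off `2N'`; and TWO real cusp forms `g₁, g₂ ∈ S₂(Γ₀(N'))` that are exact
eigenvectors of every `T_q`, `q ∤ N'` prime, with INTEGER eigenvalues `a₁(q) = a_q(W₁)` and `a₂(q) ≡ a_q(W₁) (mod 2)`, killed by every `T_ℓ`,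
`ℓ ∣ N'`; two real normalisations `c₁, c₂` making the period functionals `nᵢ(x) = cᵢ · re x(gᵢ)` INTEGER-valued on `Λ = periodHomology N'`.
CONCLUSION (`periodFunctionals_congr_mod_two`): if each `nᵢ` takes an odd value somewhere on `Λ`, then `n₁(x) ≡ n₂(x) (mod 2)` for every
`x ∈ Λ`. MECHANISM: `K = {x : n₁(x), n₂(x) both even}` contains `2Λ`, `(T_q^∨ − a_q(W₁))Λ` (exact eigenvalues, even differences), `U_ℓ^∨Λ`
and the cusp-negation differences (`{∞, (ιγι)∞}_g = conj {∞, γ∞}_g` for real `g`); (K2) says `Λ ∖ K` is a single coset, and two additive maps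
`Λ → 𝔽₂` that are both non-zero and have «both zero» cut out by one coset are equal. For `Δ > 0` the analogous statement is FALSE as stated (the
conjugation-coinvariants of `Λ/𝔪₀Λ` are then `2`-dimensional) — that is where `AlignedAtInfinity` would have to enter.

References: Buzzard, MRL 7 (2000) Prop. 2.4 [Buzzard2000LevelLoweringModTwo]; Greenberg–Vatsal, Invent. Math. 142 (2000) §3 (the shape: congruent
eigenforms have congruent canonically normalised symbols) [GreenbergVatsal2000]; Vatsal, Duke 98 (1999) Thm. (1.10) [Vatsal1999].
-/

noncomputable section

-- justification: the `Summit.BirchSwinnertonDyer.BirchSwinnertonDyer.…` path repeats a component (route-file convention)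
set_option linter.dupNamespace false

open scoped MatrixGroups ComplexConjugate ModularForm NumberField Classical
open CongruenceSubgroup Complex WeierstrassCurve IsDedekindDomain
open Literature.NumberTheory.EllipticCurves Literature.NumberTheory.EllipticCurves.ModularForms
open Literature.NumberTheory.EllipticCurves.Greenberg1999 Rat.HeightOneSpectrum
open Summit.BirchSwinnertonDyer.BirchSwinnertonDyer.Theorems.ThetaLayerLambdaCongruenceAtTwo
open Summit.BirchSwinnertonDyer.BirchSwinnertonDyer.Theorems.AlignedTransportAtTwoBuzzardKTwo

namespace Summit.BirchSwinnertonDyer.BirchSwinnertonDyer.Theorems.AlignedTransportAtTwoTwoCurvePlusLine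

/-! ## §1 Real parts of periods: the cusp-negation symmetry and scalar bookkeeping -/

section Tools

variable {N' : ℕ} [NeZero N']

/-- **`re {∞, (ιγι)∞}_g = re {∞, γ∞}_g` for a cusp form with real coefficients** (`(ιγι)∞ = −γ∞` and `{∞, −r}_g = conj {∞, r}_g`,
`modularSymbol_neg_eq_conj_holds`). [cite: CremonaAlgorithms1997, §2.1.4 and §2.8] -/
theorem re_cuspSymbol_iotaConj (g : CuspForm (Gamma0 N') 2) (hreal : ∀ n, (cuspCoeff g n).im = 0) (γ : Gamma0 N') :
    (cuspSymbol g ⟨iotaConj (γ : SL(2, ℤ)), iotaConj_coe_mem_gamma0 γ⟩).re = (cuspSymbol g γ).re := by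
  have e10 : (iotaConj (γ : SL(2, ℤ))) 1 0 = -((γ : SL(2, ℤ)) 1 0) := rfl
  have e00 : (iotaConj (γ : SL(2, ℤ))) 0 0 = (γ : SL(2, ℤ)) 0 0 := rfl
  unfold cuspSymbol
  change (if (iotaConj (γ : SL(2, ℤ))) 1 0 = 0 then (0 : ℂ) else
      modularSymbol g ((((iotaConj (γ : SL(2, ℤ))) 0 0 : ℤ) : ℚ) / (((iotaConj (γ : SL(2, ℤ))) 1 0 : ℤ) : ℚ))).re = _
  rw [e10, e00]
  by_cases hc : ((γ : SL(2, ℤ)) 1 0) = 0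
  · rw [if_pos (by rw [hc, neg_zero]), if_pos hc]
  · rw [if_neg (neg_ne_zero.mpr hc), if_neg hc, Int.cast_neg, div_neg, modularSymbol_neg_eq_conj_holds g hreal, Complex.conj_re]

/-- The real part of a REAL multiple: `re (a z) = a · re z` for `a ∈ ℤ`. [folklore] -/
theorem re_intCast_mul (a : ℤ) (z : ℂ) : ((a : ℂ) * z).re = a * z.re := by
  simp [Complex.mul_re]

end Tools

/-! ## §2 The congruence of the two period functionals -/

section Congruence

variable (W₁ : WeierstrassCurve ℚ) [W₁.IsElliptic] [W₁.IsGloballyMinimal]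

/-- **Two congruent `𝔪₀`-eigen real forms at one level have congruent integral period functionals mod `2` on `H₁(X₀(N'); ℤ)`, when the
eigen-system is that of an `S₃`-curve `W₁` with `Δ(W₁) < 0` and `Δ(W₁) ∉ ℚ₂²`** — the two-curve application of (K2)
(`…BuzzardKTwo.kTwo_of_dvd_S3`). Hypotheses: the data of `kTwo_of_dvd_S3` for `W₁` (print inputs `heckeSelfDual_torsionBy_J0`,
`buzzard2000_multiplicityOne_gamma0`); real forms `g₁ g₂ ∈ S₂(Γ₀(N'))` with `T_q gᵢ = aᵢ(q) gᵢ` (`q ∤ N'` prime, `aᵢ(q) ∈ ℤ`, `a₁(q) = a_q(W₁)`,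
`a₂(q) − a_q(W₁)` even) and `T_ℓ gᵢ = 0` (`ℓ ∣ N'` prime); reals `c₁ c₂` with `cᵢ · re x(gᵢ) ∈ ℤ` for all `x ∈ Λ`; and for each `i` some `x ∈ Λ` at
which that integer is ODD. Conclusion: for every `x ∈ Λ` the two integers `c₁ · re x(g₁)`, `c₂ · re x(g₂)` have the same parity.
[cite: Buzzard2000LevelLoweringModTwo, Prop. 2.4 and Def. 2.1–2.2 (p. 100–101)] [cite: GreenbergVatsal2000, §3 (13) (shape)] -/
theorem periodFunctionals_congr_mod_two
    (hSD : heckeSelfDual_torsionBy_J0) (hBz : buzzard2000_multiplicityOne_gamma0)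
    (ht : ∀ x : ℚ, ¬ HasRationalTwoTorsionX W₁ x) (hΔ : W₁.Δ < 0) (hΔ₂ : ∀ s : ℚ_[2], s ^ 2 ≠ (W₁.Δ : ℚ_[2]))
    {N : ℕ} [NeZero N] {f : CuspForm (Gamma0 N) 2} (hf : IsNewformOf W₁ f)
    (S : Finset ℕ) (hS : ∀ ℓ ∈ S, ℓ.Prime) (hSne : S.Nonempty)
    (N' : ℕ) [NeZero N'] (hN' : Odd N') (hNL : N * ∏ ℓ ∈ S, ℓ ^ 2 ∣ N') (hLS : ∀ p : ℕ, p.Prime → p ∣ N' → p ∈ S)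
    (hgood : ∀ v : HeightOneSpectrum (𝓞 ℚ), ¬ ((primesEquiv v : ℕ) ∣ 2 * N') → W₁.HasGoodReductionAt v)
    (g₁ g₂ : CuspForm (Gamma0 N') 2) (hreal₁ : ∀ n, (cuspCoeff g₁ n).im = 0) (hreal₂ : ∀ n, (cuspCoeff g₂ n).im = 0)
    (a₂ : ℕ → ℤ)
    (hT₁ : ∀ (q : ℕ) (hq : q.Prime), ¬ q ∣ N' →
      (haveI : NeZero q := ⟨hq.ne_zero⟩; heckeT (Gamma0 N') 2 q g₁) = ((W₁.LFunction q : ℤ) : ℂ) • g₁)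
    (hT₂ : ∀ (q : ℕ) (hq : q.Prime), ¬ q ∣ N' →
      (haveI : NeZero q := ⟨hq.ne_zero⟩; heckeT (Gamma0 N') 2 q g₂) = ((a₂ q : ℤ) : ℂ) • g₂)
    (hcong : ∀ (q : ℕ), q.Prime → ¬ q ∣ N' → Even (a₂ q - W₁.LFunction q))
    (hU₁ : ∀ (q : ℕ) (hq : q.Prime), q ∣ N' → (haveI : NeZero q := ⟨hq.ne_zero⟩; heckeT (Gamma0 N') 2 q g₁) = 0)
    (hU₂ : ∀ (q : ℕ) (hq : q.Prime), q ∣ N' → (haveI : NeZero q := ⟨hq.ne_zero⟩; heckeT (Gamma0 N') 2 q g₂) = 0)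
    (c₁ c₂ : ℝ)
    (hint₁ : ∀ x ∈ periodHomology N', ∃ z : ℤ, c₁ * (x g₁).re = z)
    (hint₂ : ∀ x ∈ periodHomology N', ∃ z : ℤ, c₂ * (x g₂).re = z)
    (hodd₁ : ∃ x ∈ periodHomology N', ∃ z : ℤ, c₁ * (x g₁).re = z ∧ Odd z)
    (hodd₂ : ∃ x ∈ periodHomology N', ∃ z : ℤ, c₂ * (x g₂).re = z ∧ Odd z)
    {x : Module.Dual ℂ (CuspForm (Gamma0 N') 2)} (hx : x ∈ periodHomology N')
    {z₁ z₂ : ℤ} (hz₁ : c₁ * (x g₁).re = z₁) (hz₂ : c₂ * (x g₂).re = z₂) : (Even z₁ ↔ Even z₂) := by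
  classical
  -- uniqueness of the integer value
  have huniq : ∀ {c : ℝ} {w : ℂ} {z z' : ℤ}, c * w.re = z → c * w.re = z' → z = z' := by
    intro c w z z' h h'
    have : (z : ℝ) = z' := h.symm.trans h'
    exact_mod_cast this
  -- the subgroup `K = {x : both integers even}`
  let K : AddSubgroup (Module.Dual ℂ (CuspForm (Gamma0 N') 2)) :=
    { carrier := {y | ∃ w₁ w₂ : ℤ, c₁ * (y g₁).re = 2 * w₁ ∧ c₂ * (y g₂).re = 2 * w₂}
      zero_mem' := ⟨0, 0, by simp, by simp⟩
      add_mem' := by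
        rintro y y' ⟨w₁, w₂, h₁, h₂⟩ ⟨w₁', w₂', h₁', h₂'⟩
        refine ⟨w₁ + w₁', w₂ + w₂', ?_, ?_⟩
        · rw [LinearMap.add_apply, Complex.add_re, mul_add, h₁, h₁']; push_cast; ring
        · rw [LinearMap.add_apply, Complex.add_re, mul_add, h₂, h₂']; push_cast; ring
      neg_mem' := by
        rintro y ⟨w₁, w₂, h₁, h₂⟩
        refine ⟨-w₁, -w₂, ?_, ?_⟩
        · rw [LinearMap.neg_apply, Complex.neg_re, mul_neg, h₁]; push_cast; ring
        · rw [LinearMap.neg_apply, Complex.neg_re, mul_neg, h₂]; push_cast; ring }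
  have hKmem : ∀ {y : Module.Dual ℂ (CuspForm (Gamma0 N') 2)},
      y ∈ K ↔ ∃ w₁ w₂ : ℤ, c₁ * (y g₁).re = 2 * w₁ ∧ c₂ * (y g₂).re = 2 * w₂ := Iff.rfl
  -- membership of `Λ`-elements in terms of parities
  have hKiff : ∀ {y : Module.Dual ℂ (CuspForm (Gamma0 N') 2)} {u₁ u₂ : ℤ}, c₁ * (y g₁).re = u₁ → c₂ * (y g₂).re = u₂ →
      (y ∈ K ↔ Even u₁ ∧ Even u₂) := by
    intro y u₁ u₂ hu₁ hu₂
    rw [hKmem]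
    constructor
    · rintro ⟨w₁, w₂, h₁, h₂⟩
      have e₁ : u₁ = 2 * w₁ := huniq hu₁ (by rw [h₁]; push_cast; ring)
      have e₂ : u₂ = 2 * w₂ := huniq hu₂ (by rw [h₂]; push_cast; ring)
      exact ⟨⟨w₁, by rw [e₁]; ring⟩, ⟨w₂, by rw [e₂]; ring⟩⟩
    · rintro ⟨⟨w₁, hw₁⟩, ⟨w₂, hw₂⟩⟩
      refine ⟨w₁, w₂, ?_, ?_⟩
      · rw [hu₁, hw₁]; push_cast; ring
      · rw [hu₂, hw₂]; push_cast; ring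
  -- (K2) for `K`
  have hpair : ∀ {y y' : Module.Dual ℂ (CuspForm (Gamma0 N') 2)}, y ∈ periodHomology N' → y' ∈ periodHomology N' →
      y ∉ K → y' ∉ K → y - y' ∈ K := by
    intro y y' hy hy' hyK hy'K
    refine kTwo_of_dvd_S3 hSD hBz W₁ ht hΔ hΔ₂ hf S hS hSne N' hN' hNL hLS hgood K ?_ ?_ ?_ ?_ hy hy' hyK hy'K
    · -- `2Λ ⊆ K`
      intro u hu
      obtain ⟨v₁, hv₁⟩ := hint₁ u hu
      obtain ⟨v₂, hv₂⟩ := hint₂ u hu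
      refine ⟨v₁, v₂, ?_, ?_⟩
      · rw [LinearMap.smul_apply, smul_eq_mul, show ((2 : ℂ) * u g₁).re = 2 * (u g₁).re by simp [Complex.mul_re], ← mul_assoc,
          mul_comm c₁, mul_assoc, hv₁]
      · rw [LinearMap.smul_apply, smul_eq_mul, show ((2 : ℂ) * u g₂).re = 2 * (u g₂).re by simp [Complex.mul_re], ← mul_assoc,
          mul_comm c₂, mul_assoc, hv₂]
    · -- `(T_q^∨ − a_q(W₁))Λ ⊆ K`
      intro q hq hqN u hu
      haveI : NeZero q := ⟨hq.ne_zero⟩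
      obtain ⟨v₁, hv₁⟩ := hint₁ u hu
      obtain ⟨v₂, hv₂⟩ := hint₂ u hu
      obtain ⟨k, hk⟩ := hcong q hq hqN
      refine ⟨0, k * v₂, ?_, ?_⟩
      · simp only [LinearMap.sub_apply, LinearMap.dualMap_apply, hT₁ q hq hqN, map_smul, LinearMap.smul_apply, smul_eq_mul]
        push_cast
        rw [sub_self, Complex.zero_re, mul_zero, mul_zero]
      · have e : ((heckeT (Gamma0 N') 2 q).dualMap u - (W₁.LFunction q : ℂ) • u) g₂ = ((a₂ q - W₁.LFunction q : ℤ) : ℂ) * u g₂ := by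
          simp only [LinearMap.sub_apply, LinearMap.dualMap_apply, hT₂ q hq hqN, map_smul, LinearMap.smul_apply, smul_eq_mul]
          push_cast; ring
        rw [e, re_intCast_mul, hk, ← mul_assoc, mul_comm c₂, mul_assoc, hv₂]
        push_cast; ring
    · -- `U_ℓ^∨Λ ⊆ K`
      intro q hq hqN u hu
      haveI : NeZero q := ⟨hq.ne_zero⟩
      refine ⟨0, 0, ?_, ?_⟩
      · rw [LinearMap.dualMap_apply, hU₁ q hq hqN, map_zero, Complex.zero_re, mul_zero]; push_cast; ring
      · rw [LinearMap.dualMap_apply, hU₂ q hq hqN, map_zero, Complex.zero_re, mul_zero]; push_cast; ring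
    · -- cusp-negation differences
      intro γ
      refine ⟨0, 0, ?_, ?_⟩
      · rw [LinearMap.sub_apply, periodFunctional_apply, periodFunctional_apply, Complex.sub_re, re_cuspSymbol_iotaConj g₁ hreal₁ γ,
          sub_self, mul_zero]; push_cast; ring
      · rw [LinearMap.sub_apply, periodFunctional_apply, periodFunctional_apply, Complex.sub_re, re_cuspSymbol_iotaConj g₂ hreal₂ γ,
          sub_self, mul_zero]; push_cast; ring
  -- integer values of a difference
  have hsub : ∀ {y y' : Module.Dual ℂ (CuspForm (Gamma0 N') 2)} {c : ℝ} {g : CuspForm (Gamma0 N') 2} {u u' : ℤ},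
      c * (y g).re = u → c * (y' g).re = u' → c * ((y - y') g).re = (u - u' : ℤ) := by
    intro y y' c g u u' hu hu'
    rw [LinearMap.sub_apply, Complex.sub_re, mul_sub, hu, hu']; push_cast; ring
  -- the parity argument
  obtain ⟨y₁, hy₁, m₁, hm₁, hm₁odd⟩ := hodd₁
  obtain ⟨y₂, hy₂, m₂, hm₂, hm₂odd⟩ := hodd₂
  obtain ⟨m₁', hm₁'⟩ := hint₂ y₁ hy₁
  obtain ⟨m₂', hm₂'⟩ := hint₁ y₂ hy₂
  have hy₁K : y₁ ∉ K := fun h ↦ (Int.not_even_iff_odd.mpr hm₁odd) ((hKiff hm₁ hm₁').mp h).1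
  have hy₂K : y₂ ∉ K := fun h ↦ (Int.not_even_iff_odd.mpr hm₂odd) ((hKiff hm₂' hm₂).mp h).2
  constructor
  · intro he₁
    by_contra he₂
    have hxK : x ∉ K := fun h ↦ he₂ ((hKiff hz₁ hz₂).mp h).2
    have hd := hpair hx hy₁ hxK hy₁K
    have hd' := ((hKiff (hsub hz₁ hm₁) (hsub hz₂ hm₁')).mp hd).1
    exact (Int.not_even_iff_odd.mpr (he₁.sub_odd hm₁odd)) hd'
  · intro he₂
    by_contra he₁
    have hxK : x ∉ K := fun h ↦ he₁ ((hKiff hz₁ hz₂).mp h).1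
    have hd := hpair hx hy₂ hxK hy₂K
    have hd' := ((hKiff (hsub hz₁ hm₂') (hsub hz₂ hm₂)).mp hd).2
    exact (Int.not_even_iff_odd.mpr (he₂.sub_odd hm₂odd)) hd'

end Congruence

end Summit.BirchSwinnertonDyer.BirchSwinnertonDyer.Theorems.AlignedTransportAtTwoTwoCurvePlusLine

end
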